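import Mathlib
import HarnessLib
import Literature.MathematicalPhysics.StatisticalMechanics.ComplexGradientStiffness
import Literature.MathematicalPhysics.StatisticalMechanics.TorusFiniteRangeDecomposition
import Summits.HubbardSuperconductivity.HubbardSuperconductivity.Theorems.ComplexGFFStiffnessDefs
import Summits.HubbardSuperconductivity.HubbardSuperconductivity.Theorems.ComplexGFFStiffnessHypACumulantGaussRep

/-!
# Crux `HypACumulant`, line `gnv` — splitting off the zero mode: `A⁻¹ = G + P_0`, the mean-zero
# Green's function `G`, and its UNIQUENESS (the socket into which `stub_frd` plugs)

Route `route-HubbardSuperconductivity-ComplexGFFStiffness`, crux item stmt-HubbardSuperconductivity-19154,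
research stub `stub_gnvOfFrd : TorusFRD 4 → GNV`.  The covariance of the normalised free measure
`μ^{(0)} = P_{A⁻¹}` (`…GaussRep`: `pertZ n K = Z_0 · E_{P_{A⁻¹}}[∏_x (1 + K(∇φ(x)))]`,
`A = −Δ_Λ + P_0`) splits as `A⁻¹ = G + P_0` into the zero mode `P_0 = |Λ|⁻¹𝟙𝟙ᵀ` and the
MEAN-ZERO GREEN'S FUNCTION `G = A⁻¹ − P_0 = A⁻¹(−Δ_Λ)A⁻¹ ⪰ 0` (`…Defs.greenMat`), the
pseudo-inverse of `−Δ_Λ`: `(−Δ_Λ) G = G (−Δ_Λ) = 1 − P_0`, `G 𝟙 = 0`.  It is `G` — the operator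
`𝒞^{(0)} = 𝒜⁻¹` of Adams–Buchholz–Kotecký–Müller on zero-average fields (arXiv:1910.13564 Ch. 6.1)
— that the finite-range decomposition `stub_frd : GradientFRD.TorusFRD 4` decomposes, and the
main result here is the UNIQUENESS statement that makes the plug exact: any zero-sum kernel `𝒢`
whose convolution operator inverts `−Δ_Λ` on mean-zero fields (clauses (o) and (ii) of
`TorusFRD`, read through the dictionary `ellOp 1 = −Δ_Λ`, `conv 𝒢 = circulant 𝒢`) satisfies
`circulant 𝒢 = G`; hence `Σ_{k=1}^{N+1} circulant 𝒞_k = G` for the kernels of `TorusFRD 4`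
(`sum_circulant_eq_greenMat_of_frd`).

## Contents (all proved; no definition, no named fact)
* zero mode: `lapMat_mulVec_const`, `zeroModeMat_mulVec`, `massMat_mulVec_const`,
  `zeroModeMat_mul_zeroModeMat`, `lapMat_mul_zeroModeMat`, `zeroModeMat_mul_lapMat`,
  `massMat_inv_mul_zeroModeMat`, `zeroModeMat_mul_massMat_inv`, `isHermitian_zeroModeMat`,
  `posSemidef_zeroModeMat`, `posSemidef_lapMat`;
* Green's function: `massMat_inv_eq_greenMat_add` (`A⁻¹ = G + P_0`), `greenMat_eq_conj`
  (`G = A⁻¹(−Δ)A⁻¹`), **`posSemidef_greenMat`**, `isHermitian_greenMat`, `greenMat_mulVec_const`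
  (`G𝟙 = 0`), **`lapMat_mul_greenMat`** / `greenMat_mul_lapMat` (`= 1 − P_0`);
* uniqueness: `eq_const_of_D_eq_zero`, `eq_const_of_lapMat_mulVec_eq_zero` (kernel of `−Δ_Λ` =
  constants), **`circulant_eq_greenMat`**;
* dictionary to `GradientFRD` (`TorusFiniteRangeDecomposition.lean`): `conv_eq_circulant_mulVec`,
  `ellOp_one_eq_lapMat_mulVec`, `isElliptic_one`, and the plug
  **`sum_circulant_eq_greenMat_of_frd`**.

## References
* S. Adams, S. Buchholz, R. Kotecký, S. Müller, arXiv:1910.13564, Ch. 6.1 (`μ^{(q)}`, `𝒞^{(q)}`,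
  the finite-range decomposition `𝒞^{(q)} = Σ_k 𝒞^{(q)}_k` on zero-average fields)
  [AdamsBuchholzKoteckyMuller2019].
* S. Buchholz, arXiv:1603.06685, Thm 2.4 (as typed in `GradientFRD.TorusFRD`) [Buchholz2016].
-/

noncomputable section
-- `Summit.<Summit>.<Problem>`: single-conjunct summit, the duplicate component is mandated (D-0017).
set_option linter.dupNamespace false

namespace Summit.HubbardSuperconductivity.HubbardSuperconductivity.Theorems.ComplexGFF
open scoped BigOperators Matrix
open Literature.MathematicalPhysics.StatisticalMechanics.ComplexGradientGFF4 (D S)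
open Literature.MathematicalPhysics.StatisticalMechanics.GradientFRD (conv ellOp fwdDiff bwdDiff
  IsElliptic)

variable {n : ℕ} [NeZero n]

/-! ### §1 The zero mode -/

/-- Gradients of constants vanish: `∇_i c = 0`. -/
theorem gradMat_mulVec_const (i : Fin 4) (c : ℝ) :
    gradMat n i *ᵥ (fun _ : Fin 4 → ZMod n => c) = 0 := by
  rw [gradMat_mulVec]; funext s; simp [D]

/-- `−Δ_Λ` kills constants. -/
theorem lapMat_mulVec_const (c : ℝ) : lapMat n *ᵥ (fun _ : Fin 4 → ZMod n => c) = 0 := by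
  rw [lapMat, Matrix.sum_mulVec]
  refine Finset.sum_eq_zero fun i _ => ?_
  rw [← Matrix.mulVec_mulVec, gradMat_mulVec_const, Matrix.mulVec_zero]

/-- `P_0 v` is the constant field `|Λ|⁻¹ Σ_x v(x)`. -/
theorem zeroModeMat_mulVec (v : (Fin 4 → ZMod n) → ℝ) :
    zeroModeMat n *ᵥ v =
      fun _ => (∑ x : Fin 4 → ZMod n, v x) / (Fintype.card (Fin 4 → ZMod n) : ℝ) := by
  funext s
  simp only [Matrix.mulVec, dotProduct, zeroModeMat, Matrix.of_apply, ← Finset.mul_sum]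
  rw [div_eq_inv_mul]

/-- `P_0` fixes constants. -/
theorem zeroModeMat_mulVec_const (c : ℝ) :
    zeroModeMat n *ᵥ (fun _ : Fin 4 → ZMod n => c) = fun _ => c := by
  rw [zeroModeMat_mulVec]
  funext s
  rw [Finset.sum_const, Finset.card_univ, nsmul_eq_mul]
  have hc : (Fintype.card (Fin 4 → ZMod n) : ℝ) ≠ 0 := by exact_mod_cast Fintype.card_ne_zero
  field_simp

/-- `A = −Δ_Λ + P_0` fixes constants. -/
theorem massMat_mulVec_const (c : ℝ) :
    massMat n *ᵥ (fun _ : Fin 4 → ZMod n => c) = fun _ => c := by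
  rw [massMat, Matrix.add_mulVec, lapMat_mulVec_const, zeroModeMat_mulVec_const, zero_add]

/-- `P_0² = P_0`. -/
theorem zeroModeMat_mul_zeroModeMat : zeroModeMat n * zeroModeMat n = zeroModeMat n := by
  ext s t
  simp only [Matrix.mul_apply, zeroModeMat, Matrix.of_apply, Finset.sum_const, Finset.card_univ,
    nsmul_eq_mul]
  have hc : (Fintype.card (Fin 4 → ZMod n) : ℝ) ≠ 0 := by exact_mod_cast Fintype.card_ne_zero
  field_simp

/-- `P_0` is symmetric. -/
theorem isHermitian_zeroModeMat : (zeroModeMat n).IsHermitian :=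
  Matrix.IsHermitian.ext fun i j => by simp [zeroModeMat]

/-- `−Δ_Λ` is symmetric. -/
theorem isHermitian_lapMat : (lapMat n).IsHermitian := by
  unfold Matrix.IsHermitian lapMat
  rw [Matrix.conjTranspose_sum]
  refine Finset.sum_congr rfl fun i _ => ?_
  rw [Matrix.conjTranspose_eq_transpose_of_trivial ((gradMat n i).transpose * gradMat n i),
    Matrix.transpose_mul, Matrix.transpose_transpose]

/-- `(−Δ_Λ) P_0 = 0`. -/
theorem lapMat_mul_zeroModeMat : lapMat n * zeroModeMat n = 0 := by
  ext s t
  have h := congrFun (lapMat_mulVec_const (n := n) ((Fintype.card (Fin 4 → ZMod n) : ℝ))⁻¹) s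
  simp only [Matrix.mulVec, dotProduct, Pi.zero_apply] at h
  simpa [Matrix.mul_apply, zeroModeMat] using h

/-- `P_0 (−Δ_Λ) = 0`. -/
theorem zeroModeMat_mul_lapMat : zeroModeMat n * lapMat n = 0 := by
  have h := congrArg Matrix.conjTranspose (lapMat_mul_zeroModeMat (n := n))
  rw [Matrix.conjTranspose_mul, isHermitian_lapMat.eq, isHermitian_zeroModeMat.eq,
    Matrix.conjTranspose_zero] at h
  exact h

/-- `A P_0 = P_0`. -/
theorem massMat_mul_zeroModeMat : massMat n * zeroModeMat n = zeroModeMat n := by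
  rw [massMat, Matrix.add_mul, lapMat_mul_zeroModeMat, zeroModeMat_mul_zeroModeMat, zero_add]

/-- `P_0 A = P_0`. -/
theorem zeroModeMat_mul_massMat : zeroModeMat n * massMat n = zeroModeMat n := by
  rw [massMat, Matrix.mul_add, zeroModeMat_mul_lapMat, zeroModeMat_mul_zeroModeMat, zero_add]

/-- `det A` is a unit (`A` is positive definite). -/
theorem isUnit_det_massMat : IsUnit (massMat n).det :=
  (Matrix.isUnit_iff_isUnit_det _).1 posDef_massMat.isUnit

/-- `A⁻¹ P_0 = P_0`. -/
theorem massMat_inv_mul_zeroModeMat : (massMat n)⁻¹ * zeroModeMat n = zeroModeMat n := by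
  have h : (massMat n)⁻¹ * (massMat n * zeroModeMat n) = (massMat n)⁻¹ * zeroModeMat n := by
    rw [massMat_mul_zeroModeMat]
  rw [← Matrix.mul_assoc, Matrix.nonsing_inv_mul _ isUnit_det_massMat, Matrix.one_mul] at h
  exact h.symm

/-- `P_0 A⁻¹ = P_0`. -/
theorem zeroModeMat_mul_massMat_inv : zeroModeMat n * (massMat n)⁻¹ = zeroModeMat n := by
  have h : zeroModeMat n * massMat n * (massMat n)⁻¹ = zeroModeMat n * (massMat n)⁻¹ := by
    rw [zeroModeMat_mul_massMat]
  rw [Matrix.mul_assoc, Matrix.mul_nonsing_inv _ isUnit_det_massMat, Matrix.mul_one] at h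
  exact h.symm

/-- `P_0 ⪰ 0`. -/
theorem posSemidef_zeroModeMat : (zeroModeMat n).PosSemidef := by
  refine Matrix.PosSemidef.of_dotProduct_mulVec_nonneg isHermitian_zeroModeMat fun v => ?_
  rw [star_trivial, dotProduct_zeroModeMat_mulVec]
  positivity

/-- `−Δ_Λ ⪰ 0`. -/
theorem posSemidef_lapMat : (lapMat n).PosSemidef := by
  refine Matrix.PosSemidef.of_dotProduct_mulVec_nonneg isHermitian_lapMat fun v => ?_
  rw [star_trivial, dotProduct_lapMat_mulVec]
  positivity

/-! ### §2 The mean-zero Green's function `G = A⁻¹ − P_0` -/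

/-- **`A⁻¹ = G + P_0`** (the covariance of `μ^{(0)}` splits into the mean-zero Green's function and
the zero mode). -/
theorem massMat_inv_eq_greenMat_add : (massMat n)⁻¹ = greenMat n + zeroModeMat n := by
  rw [greenMat, sub_add_cancel]

/-- `G = A⁻¹ (−Δ_Λ) A⁻¹`. -/
theorem greenMat_eq_conj : greenMat n = (massMat n)⁻¹ * lapMat n * (massMat n)⁻¹ := by
  have hlap : lapMat n = massMat n - zeroModeMat n := by rw [massMat, add_sub_cancel_right]
  rw [greenMat, hlap, Matrix.mul_sub, Matrix.sub_mul, Matrix.nonsing_inv_mul _ isUnit_det_massMat,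
    Matrix.one_mul, massMat_inv_mul_zeroModeMat, zeroModeMat_mul_massMat_inv]

/-- `G` is symmetric. -/
theorem isHermitian_greenMat : (greenMat n).IsHermitian := by
  rw [greenMat]
  exact isHermitian_massMat.inv.sub isHermitian_zeroModeMat

/-- **`G ⪰ 0`** (so `P_G` is a Gaussian measure). -/
theorem posSemidef_greenMat : (greenMat n).PosSemidef := by
  have h := posSemidef_lapMat.conjTranspose_mul_mul_same ((massMat n)⁻¹)
  rw [isHermitian_massMat.inv.eq] at h
  rwa [greenMat_eq_conj]

/-- **`G 𝟙 = 0`**: the Green's function kills constants (it lives on mean-zero fields). -/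
theorem greenMat_mulVec_const (c : ℝ) : greenMat n *ᵥ (fun _ : Fin 4 → ZMod n => c) = 0 := by
  have hA : (massMat n)⁻¹ *ᵥ (fun _ : Fin 4 → ZMod n => c) = fun _ => c := by
    conv_lhs => rw [← massMat_mulVec_const (n := n) c]
    rw [Matrix.mulVec_mulVec, Matrix.nonsing_inv_mul _ isUnit_det_massMat, Matrix.one_mulVec]
  rw [greenMat, Matrix.sub_mulVec, hA, zeroModeMat_mulVec_const, sub_self]

/-- **`(−Δ_Λ) G = 1 − P_0`**: `G` inverts the Laplacian on mean-zero fields. -/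
theorem lapMat_mul_greenMat : lapMat n * greenMat n = 1 - zeroModeMat n := by
  have hlap : lapMat n = massMat n - zeroModeMat n := by rw [massMat, add_sub_cancel_right]
  rw [greenMat, hlap, Matrix.sub_mul, Matrix.mul_sub, Matrix.mul_sub,
    Matrix.mul_nonsing_inv _ isUnit_det_massMat, massMat_mul_zeroModeMat,
    zeroModeMat_mul_massMat_inv, zeroModeMat_mul_zeroModeMat, sub_self, sub_zero]

/-- `G (−Δ_Λ) = 1 − P_0`. -/
theorem greenMat_mul_lapMat : greenMat n * lapMat n = 1 - zeroModeMat n := by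
  have h := congrArg Matrix.conjTranspose (lapMat_mul_greenMat (n := n))
  rw [Matrix.conjTranspose_mul, isHermitian_lapMat.eq, isHermitian_greenMat.eq,
    Matrix.conjTranspose_sub, Matrix.conjTranspose_one, isHermitian_zeroModeMat.eq] at h
  exact h

/-! ### §3 Uniqueness of the mean-zero Green's function -/

/-- A field with vanishing forward gradients is constant (the torus `(ℤ/n)^4` is connected). -/
theorem eq_const_of_D_eq_zero {u : (Fin 4 → ZMod n) → ℝ} (hD : ∀ (i : Fin 4) (s : Fin 4 → ZMod n),
    D u i s = 0) : ∀ t : Fin 4 → ZMod n, u t = u 0 := by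
  have hstep : ∀ (s : Fin 4 → ZMod n) (i : Fin 4), u (s + Pi.single i 1) = u s := fun s i => by
    have := hD i s
    unfold D at this
    linarith
  have hshift : ∀ (i : Fin 4) (k : ℕ) (s : Fin 4 → ZMod n),
      u (s + Pi.single i (k : ZMod n)) = u s := by
    intro i k
    induction k with
    | zero => intro s; simp
    | succ k ih => intro s; rw [Nat.cast_succ, Pi.single_add, ← add_assoc, hstep, ih]
  intro t
  have key : ∀ T : Finset (Fin 4), u (∑ i ∈ T, Pi.single i (t i)) = u 0 := by
    intro T
    refine Finset.induction_on T ?_ ?_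
    · simp
    · intro j T hj ih
      rw [Finset.sum_insert hj, add_comm, ← ZMod.natCast_zmod_val (t j), hshift, ih]
  have := key Finset.univ
  rwa [Finset.univ_sum_single] at this

/-- The kernel of `−Δ_Λ` consists of the constants. -/
theorem eq_const_of_lapMat_mulVec_eq_zero {u : (Fin 4 → ZMod n) → ℝ} (h : lapMat n *ᵥ u = 0) :
    ∀ t : Fin 4 → ZMod n, u t = u 0 := by
  refine eq_const_of_D_eq_zero fun i s => ?_
  have hq : ∑ s : Fin 4 → ZMod n, ∑ i : Fin 4, (D u i s) ^ 2 = 0 := by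
    rw [← dotProduct_lapMat_mulVec, h, dotProduct_zero]
  have hs := (Finset.sum_eq_zero_iff_of_nonneg (fun s _ =>
    Finset.sum_nonneg (fun i _ => sq_nonneg (D u i s)))).mp hq s (Finset.mem_univ s)
  exact pow_eq_zero_iff two_ne_zero |>.mp
    ((Finset.sum_eq_zero_iff_of_nonneg (fun i _ => sq_nonneg (D u i s))).mp hs i (Finset.mem_univ i))

/-- A zero-sum kernel's convolution operator kills constants and has mean-zero range. -/
theorem circulant_mulVec_const {𝒢 : (Fin 4 → ZMod n) → ℝ} (h0 : ∑ x, 𝒢 x = 0) (c : ℝ) :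
    Matrix.circulant 𝒢 *ᵥ (fun _ : Fin 4 → ZMod n => c) = 0 := by
  funext x
  simp only [Matrix.mulVec, dotProduct, Matrix.circulant_apply, Pi.zero_apply, ← Finset.sum_mul]
  rw [show ∑ y : Fin 4 → ZMod n, 𝒢 (x - y) = ∑ y : Fin 4 → ZMod n, 𝒢 y from
    (Equiv.subLeft x).sum_comp 𝒢, h0, zero_mul]

/-- The range of a zero-sum kernel's convolution operator is mean-zero. -/
theorem sum_circulant_mulVec {𝒢 : (Fin 4 → ZMod n) → ℝ} (h0 : ∑ x, 𝒢 x = 0)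
    (v : (Fin 4 → ZMod n) → ℝ) : ∑ x, (Matrix.circulant 𝒢 *ᵥ v) x = 0 := by
  simp only [Matrix.mulVec, dotProduct, Matrix.circulant_apply]
  rw [Finset.sum_comm]
  refine Finset.sum_eq_zero fun y _ => ?_
  rw [← Finset.sum_mul, show ∑ x : Fin 4 → ZMod n, 𝒢 (x - y) = ∑ x : Fin 4 → ZMod n, 𝒢 x from
    (Equiv.subRight y).sum_comp 𝒢, h0, zero_mul]

/-- **Uniqueness of the mean-zero Green's function.**  If a kernel `𝒢` on `Λ = (ℤ/n)^4` has zero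
sum and its convolution operator inverts `−Δ_Λ` on mean-zero fields, then `circulant 𝒢 = G`.
(These are clauses (o) and (ii) of `GradientFRD.TorusFRD` for the summed kernel, through the
dictionary below.) -/
theorem circulant_eq_greenMat {𝒢 : (Fin 4 → ZMod n) → ℝ} (h0 : ∑ x, 𝒢 x = 0)
    (hinv : ∀ φ : (Fin 4 → ZMod n) → ℝ, ∑ x, φ x = 0 →
      lapMat n *ᵥ (Matrix.circulant 𝒢 *ᵥ φ) = φ) :
    Matrix.circulant 𝒢 = greenMat n := by
  set M := Matrix.circulant 𝒢 with hM
  set N : ℝ := (Fintype.card (Fin 4 → ZMod n) : ℝ) with hN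
  have hN0 : N ≠ 0 := by rw [hN]; exact_mod_cast Fintype.card_ne_zero
  refine Matrix.ext_iff_mulVec.2 fun v => ?_
  -- split `v` into its mean and a mean-zero part `w`
  set c : ℝ := (∑ x, v x) / N with hc
  set w : (Fin 4 → ZMod n) → ℝ := v - fun _ => c with hw
  have hw0 : ∑ x, w x = 0 := by
    simp only [hw, Pi.sub_apply, Finset.sum_sub_distrib, Finset.sum_const, Finset.card_univ,
      nsmul_eq_mul]
    rw [hc]; field_simp; ring
  have hv : v = w + fun _ => c := by rw [hw, sub_add_cancel]
  have hMv : M *ᵥ v = M *ᵥ w := by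
    rw [hv, Matrix.mulVec_add, circulant_mulVec_const h0, add_zero]
  have hGv : greenMat n *ᵥ v = greenMat n *ᵥ w := by
    rw [hv, Matrix.mulVec_add, greenMat_mulVec_const, add_zero]
  rw [hMv, hGv]
  -- on the mean-zero part both are inverses of `−Δ_Λ`, so the difference is constant …
  have hlapG : lapMat n *ᵥ (greenMat n *ᵥ w) = w := by
    rw [Matrix.mulVec_mulVec, lapMat_mul_greenMat, Matrix.sub_mulVec, Matrix.one_mulVec,
      zeroModeMat_mulVec, hw0, zero_div]
    funext x; simp
  have hker : lapMat n *ᵥ (M *ᵥ w - greenMat n *ᵥ w) = 0 := by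
    rw [Matrix.mulVec_sub, hinv w hw0, hlapG, sub_self]
  have hconst := eq_const_of_lapMat_mulVec_eq_zero hker
  -- … and has zero mean, hence vanishes
  have hsumM : ∑ x, (M *ᵥ w) x = 0 := sum_circulant_mulVec h0 w
  have hsumG : ∑ x, (greenMat n *ᵥ w) x = 0 := by
    have h1 : ∑ x, (greenMat n *ᵥ w) x = (fun _ : Fin 4 → ZMod n => (1 : ℝ)) ⬝ᵥ (greenMat n *ᵥ w) := by
      simp [dotProduct]
    rw [h1, Matrix.dotProduct_mulVec, ← Matrix.mulVec_transpose]
    have ht : (greenMat n)ᵀ = greenMat n := by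
      have := isHermitian_greenMat (n := n)
      unfold Matrix.IsHermitian at this
      rwa [Matrix.conjTranspose_eq_transpose_of_trivial] at this
    rw [ht, greenMat_mulVec_const, zero_dotProduct]
  have hd0 : (M *ᵥ w - greenMat n *ᵥ w) 0 = 0 := by
    have hs : ∑ x, (M *ᵥ w - greenMat n *ᵥ w) x = 0 := by
      simp only [Pi.sub_apply, Finset.sum_sub_distrib, hsumM, hsumG, sub_zero]
    rw [Finset.sum_congr rfl (fun x _ => hconst x), Finset.sum_const, Finset.card_univ,
      nsmul_eq_mul] at hs
    rcases mul_eq_zero.1 hs with h | h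
    · exact absurd h hN0
    · exact h
  funext x
  have := hconst x
  rw [hd0] at this
  exact sub_eq_zero.1 this

/-! ### §4 Dictionary to `GradientFRD.TorusFRD` and the plug -/

omit [NeZero n] in
/-- The fact file's forward difference is the model's gradient: `∇_i f = ∂_i f`. -/
theorem fwdDiff_eq_D (i : Fin 4) (f : (Fin 4 → ZMod n) → ℝ) : fwdDiff i f = fun x => D f i x := rfl

/-- The fact file's convolution is the circulant matrix action: `𝒞 ⋆ φ = circulant 𝒞 · φ`. -/
theorem conv_eq_circulant_mulVec (𝒞 φ : (Fin 4 → ZMod n) → ℝ) :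
    conv 𝒞 φ = Matrix.circulant 𝒞 *ᵥ φ := by
  funext x
  simp [conv, Matrix.mulVec, dotProduct, Matrix.circulant_apply]

/-- **The fact file's operator `𝒜_1 = Σ_i ∇_i^* ∇_i` is `−Δ_Λ`**: `ellOp 1 φ = lapMat n · φ`. -/
theorem ellOp_one_eq_lapMat_mulVec (φ : (Fin 4 → ZMod n) → ℝ) :
    ellOp (1 : Matrix (Fin 4) (Fin 4) ℝ) φ = lapMat n *ᵥ φ := by
  funext x
  -- left: `Σ_i [∂_iφ(x − e_i) − ∂_iφ(x)]`
  have hL : ellOp (1 : Matrix (Fin 4) (Fin 4) ℝ) φ x =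
      ∑ i : Fin 4, (D φ i (x - Pi.single i 1) - D φ i x) := by
    simp only [ellOp, Matrix.one_apply, ite_mul, one_mul, zero_mul, Finset.sum_ite_eq,
      Finset.mem_univ, if_true, bwdDiff, fwdDiff_eq_D]
  -- right: `Σ_i (∇_iᵀ ∇_i φ)(x)` is the same
  have hR : (lapMat n *ᵥ φ) x = ∑ i : Fin 4, (D φ i (x - Pi.single i 1) - D φ i x) := by
    rw [lapMat, Matrix.sum_mulVec, Finset.sum_apply]
    refine Finset.sum_congr rfl fun i _ => ?_
    rw [← Matrix.mulVec_mulVec, gradMat_mulVec, Matrix.mulVec, dotProduct]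
    simp only [Matrix.transpose_apply, gradMat, sub_mul, ite_mul, one_mul, zero_mul,
      Finset.sum_sub_distrib]
    have h1 : ∑ s : Fin 4 → ZMod n, (if x = s + Pi.single i 1 then D φ i s else 0) =
        D φ i (x - Pi.single i 1) := by
      have : ∀ s : Fin 4 → ZMod n, (x = s + Pi.single i 1) = (s = x - Pi.single i 1) := fun s =>
        propext ⟨fun h => by rw [h, add_sub_cancel_right], fun h => by rw [h, sub_add_cancel]⟩
      simp_rw [this]
      rw [Finset.sum_ite_eq' Finset.univ (x - Pi.single i 1)]
      simp
    have h2 : ∑ s : Fin 4 → ZMod n, (if x = s then D φ i s else 0) = D φ i x := by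
      rw [Finset.sum_ite_eq Finset.univ x]; simp
    rw [h1, h2]
  rw [hL, hR]

/-- The identity coefficient matrix is elliptic: `𝟙 ∈ 𝓛(1/2, 2)`. -/
theorem isElliptic_one : IsElliptic (1 / 2 : ℝ) 2 (1 : Matrix (Fin 4) (Fin 4) ℝ) := by
  refine ⟨Matrix.isSymm_one, fun z => ?_⟩
  have hq : ∑ i : Fin 4, ∑ j : Fin 4, z i * (1 : Matrix (Fin 4) (Fin 4) ℝ) i j * z j =
      ∑ i : Fin 4, (z i) ^ 2 := by
    refine Finset.sum_congr rfl fun i _ => ?_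
    simp only [Matrix.one_apply, mul_ite, mul_one, mul_zero, ite_mul, zero_mul, Finset.sum_ite_eq,
      Finset.mem_univ, if_true, sq]
  rw [hq]
  have h0 : 0 ≤ ∑ i : Fin 4, (z i) ^ 2 := by positivity
  constructor <;> linarith

/-- **The plug.**  For kernels `𝒞_1, …, 𝒞_{N+1}` with zero sums whose summed convolution operator
inverts `𝒜_1 = −Δ_Λ` on mean-zero fields — clauses (o) and (ii) of `GradientFRD.TorusFRD 4` at
`A = 𝟙` — the sum of the circulant (covariance) matrices IS the mean-zero Green's function:
`Σ_k circulant 𝒞_k = G`.  With `A⁻¹ = G + P_0` and `P_{C₁+C₂} = P_{C₁} ∗ P_{C₂}` this turns the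
representation `pertZ = Z_0 · E_{P_{A⁻¹}}[…]` into progressive integration over the scales. -/
theorem sum_circulant_eq_greenMat_of_frd {N : ℕ} (𝒞 : ℕ → (Fin 4 → ZMod n) → ℝ)
    (h0 : ∀ k ∈ Finset.Icc 1 (N + 1), ∑ x, 𝒞 k x = 0)
    (hinv : ∀ φ : (Fin 4 → ZMod n) → ℝ, ∑ x, φ x = 0 →
      ellOp (1 : Matrix (Fin 4) (Fin 4) ℝ)
        (conv (fun x => ∑ k ∈ Finset.Icc 1 (N + 1), 𝒞 k x) φ) = φ) :
    ∑ k ∈ Finset.Icc 1 (N + 1), Matrix.circulant (𝒞 k) = greenMat n := by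
  have hsum : ∑ k ∈ Finset.Icc 1 (N + 1), Matrix.circulant (𝒞 k) =
      Matrix.circulant (fun x => ∑ k ∈ Finset.Icc 1 (N + 1), 𝒞 k x) := by
    ext i j
    simp [Matrix.sum_apply, Matrix.circulant_apply]
  rw [hsum]
  refine circulant_eq_greenMat ?_ fun φ hφ => ?_
  · rw [Finset.sum_comm]
    exact Finset.sum_eq_zero fun k hk => h0 k hk
  · have h := hinv φ hφ
    rwa [ellOp_one_eq_lapMat_mulVec, conv_eq_circulant_mulVec] at h

end Summit.HubbardSuperconductivity.HubbardSuperconductivity.Theorems.ComplexGFF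

end
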